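import Summits.CriticalPhenomena.PercolationContinuityZ3.Theorems.Transplant.AutChartDatum
import HarnessLib

/-!
# The chart datum of a transitive action by automorphisms (NO finite stabilisers), II: (κ′) the cylinders are connected from some width on;
# THE ONE-TYPE SCALED SKELETON

builds on p205010 (kernel theorem, internal audit signed; external expert review pending) — nothing in this file uses p205010; nothing here is a claim about the OPEN node `SamePDropOfSkeletonFrmScaled₁`.
Lane `prim-bschramm`, seat `prim-bschramm-p4` gen 25 (PART C3 of `P4-GENERAL.md` §47).  Helper file (`--supports stmt-CriticalPhenomena-4575 --as helper`).

(κ′) exactly as for Cayley graphs (`CayleySkeletonScaledConn`) but on the ORBIT: reduce both chart coordinates into `[0, N)` by exact-step edges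
inside the cylinder (`reduce_coord`), then join the reduced vertex `v` to `t` inside `Λ_{ℓ₀}`, `ℓ₀ = N R₁ + N + N m`: a KERNEL walk from `t` to
`k • t` (`ker_inBox`, radius `Nm`) followed by the `k`-translate of a walk from `t` to the representative of the chart value of `v` (radius
`N R₁`).  Then **`ChartDatum.skeleton : PlanarSkeletonFrmScaled G`** with ONE type `{t}`: chart `ψ ∘ sec`, `L = N`, frames `a • ·`, exact
`N`-steps, cylinders connected from `ℓ₀` on.
[cite: KozmaNitzan2024, §4 pp. 15–16 (boxes; Lemma 8)] [cite: MartineauTassion2017, §3.2] [cite: BenjaminiSchramm1996, §2]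
-/

noncomputable section

namespace Summit.CriticalPhenomena.PercolationContinuityZ3.Theorems.Transplant

open SimpleGraph Filter Literature.Barriers.CriticalPhenomena Literature.Probability.LatticeModels Literature.Probability.Percolation
open scoped Classical

namespace AutChart

variable {V : Type} {G : SimpleGraph V} {A : Type} [Group A] [MulAction A V] {t : V}

namespace ChartDatum

/-! ### (κ′): the cylinders `{φ − φ t ∈ Λ_ℓ}` are connected from some width on -/

/-- Every vertex is at finite distance from `t`. [folklore] -/
theorem exists_rad (D : ChartDatum G A t) (v : V) : ∃ r : ℕ, v ∈ graphBall G t r := by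
  obtain ⟨w⟩ := D.conn.preconnected t v
  exact ⟨w.length, w, le_rfl⟩

/-- A radius at which `v` is seen from `t`. [folklore] -/
def rad (D : ChartDatum G A t) (v : V) : ℕ := Classical.choose (D.exists_rad v)

/-- `v ∈ B(t, rad v)`. [folklore] -/
theorem mem_graphBall_rad (D : ChartDatum G A t) (v : V) : v ∈ graphBall G t (D.rad v) := Classical.choose_spec (D.exists_rad v)

/-- **The representatives' radius**: every reduced chart value that occurs has a representative vertex in `B(t, R₁)`. [folklore] -/
def R1 (D : ChartDatum G A t) : ℕ := ((Finset.range D.N) ×ˢ (Finset.range D.N)).sup fun ab =>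
  if h : ∃ v : V, D.chart v = CayleyScaled.vec ab.1 ab.2 then D.rad (Classical.choose h) else 0

/-- **The width floor `ℓ₀ = N R₁ + N + N m`.** [folklore] -/
def ℓ₀ (D : ChartDatum G A t) : ℕ := D.N * D.R1 + D.N + D.N * D.m

/-- **A reduced vertex (`φ ∈ [0, N)²`) is joined to `t` inside the box of radius `ℓ₀`**: a kernel walk to `k • t`, then the `k`-translate of a walk
to the representative of its chart value. [folklore] -/
theorem inBox_of_reduced (D : ChartDatum G A t) {v : V} (hv : ∀ i : Fin 2, 0 ≤ D.chart v i ∧ D.chart v i < D.N) : D.InBox D.ℓ₀ t v := by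
  set a : ℕ := (D.chart v 0).toNat with ha
  set b : ℕ := (D.chart v 1).toNat with hb
  have h0 := hv 0
  have h1 := hv 1
  have hφv : D.chart v = CayleyScaled.vec a b := by
    funext i; fin_cases i
    · show D.chart v 0 = ((D.chart v 0).toNat : ℤ); rw [Int.toNat_of_nonneg h0.1]
    · show D.chart v 1 = ((D.chart v 1).toNat : ℤ); rw [Int.toNat_of_nonneg h1.1]
  have hex : ∃ v' : V, D.chart v' = CayleyScaled.vec a b := ⟨v, hφv⟩
  set r : V := Classical.choose hex with hr
  have hφr : D.chart r = CayleyScaled.vec a b := Classical.choose_spec hex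
  have hab : (a, b) ∈ (Finset.range D.N) ×ˢ (Finset.range D.N) := by
    rw [Finset.mem_product, Finset.mem_range, Finset.mem_range]
    constructor
    · have : (a : ℤ) < D.N := by rw [ha, Int.toNat_of_nonneg h0.1]; exact h0.2
      exact_mod_cast this
    · have : (b : ℤ) < D.N := by rw [hb, Int.toNat_of_nonneg h1.1]; exact h1.2
      exact_mod_cast this
  have hrad : D.rad r ≤ D.R1 := by
    have h := Finset.le_sup (f := fun ab : ℕ × ℕ => if h : ∃ v : V, D.chart v = CayleyScaled.vec ab.1 ab.2 then D.rad (Classical.choose h) else 0) hab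
    simp only [dif_pos hex] at h
    exact h
  -- the kernel element carrying `r` to `v`
  set k : A := D.sec v * (D.sec r)⁻¹ with hk_def
  have hk : D.ψ k = 0 := by
    rw [hk_def, D.ψ_mul, D.ψ_inv, D.chart_sec, D.chart_sec, hφv, hφr, add_neg_cancel]
  have hkr : k • r = v := by
    have h1 : (D.sec r)⁻¹ • r = t := by rw [inv_smul_eq_iff, D.sec_smul]
    rw [hk_def, mul_smul, h1, D.sec_smul]
  have h1' : D.InBox (D.N * D.m) t (k • t) := D.ker_inBox hk
  have h2' : D.InBox (D.N * D.R1) t r := D.inBox_mono (Nat.mul_le_mul_left _ hrad) (D.inBox_of_mem_graphBall (D.mem_graphBall_rad r))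
  have h3' := D.inBox_smul k (S := 0) (fun i => by rw [hk, Pi.zero_apply, abs_zero]; rfl) h2'
  rw [Nat.zero_add, hkr] at h3'
  exact D.inBox_trans (D.inBox_mono (by unfold ℓ₀; omega) h1') (D.inBox_mono (by unfold ℓ₀; omega) h3')

/-- The deviation of a chart coordinate from the block `[0, N)` (a termination measure for the reduction). [folklore] -/
def excess (D : ChartDatum G A t) (x : ℤ) : ℕ := (-x).toNat + (x - D.N + 1).toNat

/-- **Reduction of ONE coordinate inside the cylinder**: from any vertex of the cylinder `‖φ‖_∞ ≤ ℓ` (`ℓ ≥ N`), single exact-step edges lead,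
inside the cylinder, to a vertex whose `i`-th chart coordinate lies in `[0, N)` and whose other coordinate is unchanged. [folklore] -/
theorem reduce_coord (D : ChartDatum G A t) (i : Fin 2) {ℓ : ℕ} (hℓ : D.N ≤ ℓ) :
    ∀ (n : ℕ) (v : V) (hvm : v ∈ {w | D.chart w - D.chart t ∈ box 2 ℓ}), D.excess (D.chart v i) ≤ n →
      ∃ (v' : V) (hv'm : v' ∈ {w | D.chart w - D.chart t ∈ box 2 ℓ}),
        (0 ≤ D.chart v' i ∧ D.chart v' i < D.N) ∧ (∀ j, j ≠ i → D.chart v' j = D.chart v j) ∧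
        (G.induce {w | D.chart w - D.chart t ∈ box 2 ℓ}).Reachable ⟨v, hvm⟩ ⟨v', hv'm⟩ := by
  intro n
  induction n with
  | zero =>
    intro v hvm hex
    refine ⟨v, hvm, ?_, fun j _ => rfl, Reachable.refl _⟩
    unfold excess at hex
    constructor <;> omega
  | succ n ih =>
    intro v hvm hex
    by_cases hin : 0 ≤ D.chart v i ∧ D.chart v i < D.N
    · exact ⟨v, hvm, hin, fun j _ => rfl, Reachable.refl _⟩
    · have hvbox : D.chart v ∈ box 2 ℓ := by
        have := hvm; simp only [Set.mem_setOf_eq, D.chart_base, sub_zero] at this; exact this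
      rw [mem_box] at hvbox
      by_cases hneg : D.chart v i < 0
      · obtain ⟨hadj, hφ₁⟩ := D.step_pos v i
        set v₁ := (D.sec v * D.gen i) • t with hv₁
        have hφ₁i : D.chart v₁ i = D.chart v i + D.N := by rw [hφ₁, Pi.add_apply, Pi.single_eq_same]
        have hφ₁j : ∀ j, j ≠ i → D.chart v₁ j = D.chart v j := fun j hj => by
          rw [hφ₁, Pi.add_apply, Pi.single_eq_of_ne hj, add_zero]
        have hv₁m : v₁ ∈ {w | D.chart w - D.chart t ∈ box 2 ℓ} := by
          show D.chart v₁ - D.chart t ∈ box 2 ℓ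
          rw [D.chart_base, sub_zero, mem_box]
          intro j
          by_cases hj : j = i
          · subst hj; rw [hφ₁i]; have := hvbox j; constructor <;> omega
          · rw [hφ₁j j hj]; exact hvbox j
        have hex₁ : D.excess (D.chart v₁ i) ≤ n := by
          have hN1 := D.one_le_N
          rw [hφ₁i]; unfold excess at hex ⊢; omega
        obtain ⟨v', hv'm, hv'in, hv'j, hreach⟩ := ih v₁ hv₁m hex₁
        refine ⟨v', hv'm, hv'in, fun j hj => by rw [hv'j j hj, hφ₁j j hj], ?_⟩
        have hadj' : (G.induce {w | D.chart w - D.chart t ∈ box 2 ℓ}).Adj ⟨v, hvm⟩ ⟨v₁, hv₁m⟩ := induce_adj.2 hadj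
        exact hadj'.reachable.trans hreach
      · have hge : (D.N : ℤ) ≤ D.chart v i := by
          push Not at hneg
          by_contra hlt; push Not at hlt; exact hin ⟨hneg, hlt⟩
        obtain ⟨hadj, hφ₁⟩ := D.step_neg v i
        set v₁ := (D.sec v * (D.gen i)⁻¹) • t with hv₁
        have hφ₁i : D.chart v₁ i = D.chart v i - D.N := by rw [hφ₁, Pi.sub_apply, Pi.single_eq_same]
        have hφ₁j : ∀ j, j ≠ i → D.chart v₁ j = D.chart v j := fun j hj => by
          rw [hφ₁, Pi.sub_apply, Pi.single_eq_of_ne hj, sub_zero]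
        have hv₁m : v₁ ∈ {w | D.chart w - D.chart t ∈ box 2 ℓ} := by
          show D.chart v₁ - D.chart t ∈ box 2 ℓ
          rw [D.chart_base, sub_zero, mem_box]
          intro j
          by_cases hj : j = i
          · subst hj; rw [hφ₁i]; have := hvbox j; constructor <;> omega
          · rw [hφ₁j j hj]; exact hvbox j
        have hex₁ : D.excess (D.chart v₁ i) ≤ n := by
          have hN1 := D.one_le_N
          rw [hφ₁i]; unfold excess at hex ⊢; omega
        obtain ⟨v', hv'm, hv'in, hv'j, hreach⟩ := ih v₁ hv₁m hex₁
        refine ⟨v', hv'm, hv'in, fun j hj => by rw [hv'j j hj, hφ₁j j hj], ?_⟩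
        have hadj' : (G.induce {w | D.chart w - D.chart t ∈ box 2 ℓ}).Adj ⟨v, hvm⟩ ⟨v₁, hv₁m⟩ := induce_adj.2 hadj
        exact hadj'.reachable.trans hreach

/-- **(κ′) THE CYLINDERS `{φ − φ t ∈ Λ_ℓ}`, `ℓ ≥ ℓ₀`, ARE CONNECTED** (reduce both coordinates by exact steps inside the cylinder, then join the
reduced vertex to `t` inside the box of radius `ℓ₀`). [cite: KozmaNitzan2024, §4 p. 15 (boxes)] -/
theorem cyl_connected_of_le (D : ChartDatum G A t) {ℓ : ℕ} (hℓ : D.ℓ₀ ≤ ℓ) : (G.induce {w | D.chart w - D.chart t ∈ box 2 ℓ}).Connected := by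
  have hNℓ : D.N ≤ ℓ := le_trans (by unfold ℓ₀; omega) hℓ
  have ht : t ∈ {w | D.chart w - D.chart t ∈ box 2 ℓ} := by
    show D.chart t - D.chart t ∈ box 2 ℓ; rw [sub_self]; exact zero_mem_box 2 ℓ
  have key : ∀ x : {w | D.chart w - D.chart t ∈ box 2 ℓ}, (G.induce {w | D.chart w - D.chart t ∈ box 2 ℓ}).Reachable ⟨t, ht⟩ x := by
    rintro ⟨v, hvm⟩
    obtain ⟨v₁, hv₁m, hv₁in, _, hr₁⟩ := D.reduce_coord 0 hNℓ _ v hvm le_rfl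
    obtain ⟨v₂, hv₂m, hv₂in, hv₂j, hr₂⟩ := D.reduce_coord 1 hNℓ _ v₁ hv₁m le_rfl
    have hred : ∀ i : Fin 2, 0 ≤ D.chart v₂ i ∧ D.chart v₂ i < D.N := by
      intro i
      fin_cases i
      · show 0 ≤ D.chart v₂ 0 ∧ D.chart v₂ 0 < D.N
        rw [hv₂j 0 (by decide)]; exact hv₁in
      · exact hv₂in
    exact (D.reach_of_inBox hℓ (D.inBox_of_reduced hred) ht hv₂m).trans (hr₁.trans hr₂).symm
  exact (connected_iff _).2 ⟨fun a b => (key a).symm.trans (key b), ⟨⟨t, ht⟩⟩⟩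

/-! ### The one-type scaled skeleton of `G` -/

/-- **THE ONE-TYPE SCALED SKELETON OF `G` from a chart datum** (NO finite stabilisers): chart `ψ ∘ sec`, `L = N`, frames `a • ·`, base vertex `t`,
exact `N`-steps `v ↦ (sec v · gen i^{±1}) • t`, cylinders connected from `ℓ₀` on. [cite: KozmaNitzan2024, §4 p. 16 (Lemma 8)]
[cite: MartineauTassion2017, §3.2] -/
def skeleton [G.LocallyFinite] (D : ChartDatum G A t) : PlanarSkeletonFrmScaled G where
  φ := D.chart
  L := D.N
  lip := fun _ _ huv i => D.chart_lip huv i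
  types := {t}
  frame := fun v => ⟨t, Finset.mem_singleton_self t, smulIso D.act (D.sec v), D.sec_smul v, fun w => by
    rw [smulIso_apply, D.chart_smul, D.chart_base, sub_zero, D.chart_sec, add_comm]⟩
  Δ := G.degree t
  degree_le := fun v => by
    obtain ⟨a, rfl⟩ := D.tr v
    rw [← smulIso_apply D.act a t, Iso.degree_eq]
  N := D.N
  one_le_N := D.one_le_N
  step := fun v i σ => by
    rcases Int.units_eq_one_or σ with rfl | rfl
    · exact ⟨_, (D.step_pos v i).1, by rw [(D.step_pos v i).2, Units.val_one, mul_one]⟩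
    · exact ⟨_, (D.step_neg v i).1, by
        rw [(D.step_neg v i).2, Units.val_neg, Units.val_one, mul_neg, mul_one, Pi.single_neg, sub_eq_add_neg]⟩
  ℓ₀ := D.ℓ₀
  cyl_connected := fun t' ht' ℓ hℓ => by
    rw [Finset.mem_singleton] at ht'
    subst ht'
    exact D.cyl_connected_of_le hℓ

end ChartDatum

end AutChart

end Summit.CriticalPhenomena.PercolationContinuityZ3.Theorems.Transplant

end
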